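import Summits.CriticalPhenomena.SAWScalingLimit.Theses.SAWReversalUpgrade
import HarnessLib

/-!
# Strategist sketch for crux `SAWReversalUpgrade.NoDeepReturn` (stmt-CriticalPhenomena-18004):
# the typed strengthenings and the typed Markov-cut decomposition of `STRATEGY-CENSUS.md`

Seat `planner-cstrat-stmt-CriticalPhenomena-18004-b1-0` (crux-strategist before the lead, 2026-08-17).
Nothing here is filed as an item or registered as a line; the census explains, per statement, why
(refutable as typed / crux reworded / open without a tool). Everything elaborates; the only purpose
of the proofs is to certify the logical relations the census asserts (`_of_` glue, weakenings).

* §1 events: `PolyDeepReturn` (verbatim the crux's event), `VertexFarNear` (vertex-level twin);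
* §2 STRENGTHEN: `UniformRootNoReturn` (S⁺₁, `r` uniform over domains — refuted on paper by fjords,
  ULC makes `r` domain-dependent), `RootReturnPowerLaw` (S⁺₂, annealed power decay per domain),
  `RootPenetrationSupAt cut` (S⁺₃ = piece 1 of the Markov cut, sup over first-entry pasts; two
  cuts `ballCut`, `componentCut`);
* §3 DECOMPOSITION D1 (Markov first-entry cut): `FirstEntryReduction` (annealed domain-Markov
  reduction, provable, L), `PolylineToVertex` (polyline → vertex event, provable, M), and the
  kernel-checked glue `noDeepReturn_of_markovCut : RootPenetrationSupAt ballCut →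
  FirstEntryReduction → PolylineToVertex → NoDeepReturn`;
* §4 the regime piece `LocalRootNoReturn` (lattice-local return next to the root) and
  `localRootNoReturn_of_noDeepReturn` (it is a WEAKENING of the crux — and already frontier-open,
  census §Decomposition D2);
* §5 `noDeepReturn_of_uniform` (S⁺₁ → crux, instantiation).
-/

noncomputable section

namespace Summit.CriticalPhenomena.SAWScalingLimit.Cruxes.NoDeepReturn.Strategist

open MeasureTheory Filter Topology Set Metric
open scoped NNReal ENNReal
open Literature.Probability.RandomPlanarGeometry
open Literature.Probability.RandomPlanarGeometry.SAW
open Literature.Probability.LatticeModels (Site meshPoint discreteDomainGraph)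

/-- The crux, by name. -/
abbrev Crux : Prop := Summit.CriticalPhenomena.SAWScalingLimit.Theses.SAWReversalUpgrade.NoDeepReturn

/-! ## §1 Events -/

/-- The crux's event, verbatim: the drawn polyline is `ε`-far from `c` at a time `s` and `r`-close
to `c` at a later time `t > s`. -/
def PolyDeepReturn {Ω : Set ℂ} {δ : ℝ} {u v : Site 2} (ε r : ℝ) (c : ℂ) (γ : DomainSAW Ω δ u v) :
    Prop :=
  ∃ s t : unitInterval, s < t ∧ ε ≤ dist (γ.walk.toCurve (meshPoint δ) s) c ∧
    dist (γ.walk.toCurve (meshPoint δ) t) c ≤ r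

/-- Vertex-level twin: a vertex of the walk lies in `O` and a LATER vertex lies in `N`. -/
def VertexFarNear {Ω : Set ℂ} {δ : ℝ} {u v : Site 2} (O N : Set ℂ) (γ : DomainSAW Ω δ u v) :
    Prop :=
  ∃ i j : ℕ, i < j ∧ j ≤ γ.walk.length ∧ meshPoint δ (γ.walk.getVert i) ∈ O ∧
    meshPoint δ (γ.walk.getVert j) ∈ N

/-- A FIRST-ENTRY PAST for the cut set `O`: a self-avoiding lattice prefix from `u` to `x` all of
whose vertices but the last have mesh points outside `O`, the last one inside. -/
def FirstEntryPast (Ω : Set ℂ) (δ : ℝ) (O : Set ℂ) {u x : Site 2}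
    (α : (discreteDomainGraph Ω δ).Walk u x) : Prop :=
  α.IsPath ∧ (∀ w ∈ α.support.dropLast, meshPoint δ w ∉ O) ∧ meshPoint δ x ∈ O

/-- The continuation avoids the past (all vertices of `β` off `α` minus its tip). -/
def AvoidsPast {Ω : Set ℂ} {δ : ℝ} {u x v : Site 2} (α : (discreteDomainGraph Ω δ).Walk u x)
    (β : DomainSAW Ω δ x v) : Prop :=
  ∀ w ∈ β.walk.support, w ∉ α.support.dropLast

/-- The continuation DIVES into `N` (visits a vertex with mesh point in `N`). -/
def Dives {Ω : Set ℂ} {δ : ℝ} {x v : Site 2} (N : Set ℂ) (β : DomainSAW Ω δ x v) : Prop :=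
  ∃ j ≤ β.walk.length, meshPoint δ (β.walk.getVert j) ∈ N

/-! ## §2 Strengthenings (typed; fates in the census) -/

/-- S⁺₁ — `r` UNIFORM over Dobrushin domains and endpoint approximations. Refuted on paper (census
§Strengthen S⁺₁): a Jordan domain with a fjord of `D` returning within `r/2` of `a` after reaching
distance `2ε` forces the event with law `1`; per-domain `r` is exactly what uniform local
connectedness of a Jordan domain provides. -/
def UniformRootNoReturn : Prop :=
  ∀ ε : ℝ, 0 < ε → ∀ η : ℝ, 0 < η → ∃ r : ℝ, 0 < r ∧
    ∀ (D : DobrushinDomain) (a b : ℝ → Site 2), IsEndpointApprox D a b →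
      ∀ᶠ δ in 𝓝[>] (0 : ℝ), law D.carrier δ (a δ) (b δ) {γ | PolyDeepReturn ε r (D.pt 0) γ}
        ≤ ENNReal.ofReal η

/-- S⁺₂ — annealed POWER decay per domain (predicted exponent gap `33/8 − 5/8 = 7/2` at a flat
boundary point: boundary 3-leg versus 1-leg, `n = 0`). Believed; no induction is available without
quasi-multiplicativity of the two-pinned `x_c`-law (census §Strengthen S⁺₂). -/
def RootReturnPowerLaw : Prop :=
  ∀ (D : DobrushinDomain) (a b : ℝ → Site 2), IsEndpointApprox D a b →
    ∃ C β r₀ : ℝ, 0 < C ∧ 0 < β ∧ 0 < r₀ ∧ ∀ ε r : ℝ, 0 < r → r < ε → ε ≤ r₀ →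
      ∀ᶠ δ in 𝓝[>] (0 : ℝ), law D.carrier δ (a δ) (b δ) {γ | PolyDeepReturn ε r (D.pt 0) γ}
        ≤ ENNReal.ofReal (C * (r / ε) ^ β)

/-- The round-ball cut: first exit of the closed ball `B̄(a, E)`. -/
def ballCut (D : DobrushinDomain) (E : ℝ) : Set ℂ := (closedBall (D.pt 0) E)ᶜ

/-- The bubble-free cut: first entry into the component of `b` in `D ∖ B̄(a, E)`. -/
def componentCut (D : DobrushinDomain) (E : ℝ) : Set ℂ :=
  connectedComponentIn (D.carrier \ closedBall (D.pt 0) E) (D.pt 1)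

/-- S⁺₃ = piece 1 of the Markov cut — SUP over first-entry pasts of the conditional dive weight:
for the cut set `cut D E`, every first-entry past `α` (tip `x`) has continuation `x_c`-weight of
"avoid `α` and dive into `B̄(a, ρ)`" at most `η` times the continuation weight of "avoid `α`",
uniformly in small `δ`. Refutable AS TYPED for both cuts (census §Decomposition D1: finger /
junction near-touch / gapped root — a forced dive with conditional weight ratio `1`). -/
def RootPenetrationSupAt (cut : DobrushinDomain → ℝ → Set ℂ) : Prop :=
  ∀ (D : DobrushinDomain) (a b : ℝ → Site 2), IsEndpointApprox D a b →
    ∀ E : ℝ, 0 < E → ∀ η : ℝ, 0 < η → ∃ ρ : ℝ, 0 < ρ ∧ ρ < E ∧ ∀ᶠ δ in 𝓝[>] (0 : ℝ),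
      ∀ (x : Site 2) (α : (discreteDomainGraph D.carrier δ).Walk (a δ) x),
        FirstEntryPast D.carrier δ (cut D E) α →
          weight D.carrier δ x (b δ) {β | AvoidsPast α β ∧ Dives (closedBall (D.pt 0) ρ) β}
            ≤ ENNReal.ofReal η * weight D.carrier δ x (b δ) {β | AvoidsPast α β}

/-! ## §3 Decomposition D1 — the Markov first-entry cut -/

/-- Piece 2 (provable, L): the ANNEALED domain-Markov reduction. If every first-entry past for `O`
has conditional dive-into-`N` weight ratio `≤ η`, then the law of "a vertex in `O`, a later vertex in
`N`" is `≤ η` (sum the cylinder factorisation `weight_cylinder_split` over the first-entry prefixes;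
the cylinders are disjoint; normalise). -/
def FirstEntryReduction : Prop :=
  ∀ (Ω : Set ℂ), Bornology.IsBounded Ω → ∀ (δ : ℝ), 0 < δ → ∀ (O N : Set ℂ) (u v : Site 2)
    (η : ℝ), 0 ≤ η →
    (∀ (x : Site 2) (α : (discreteDomainGraph Ω δ).Walk u x), FirstEntryPast Ω δ O α →
      weight Ω δ x v {β | AvoidsPast α β ∧ Dives N β}
        ≤ ENNReal.ofReal η * weight Ω δ x v {β | AvoidsPast α β}) →
    law Ω δ u v {γ | VertexFarNear O N γ} ≤ ENNReal.ofReal η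

/-- Piece 3 (provable, M): polyline event ⇒ vertex event with an extra `δ` of room (a polyline
point lies on a lattice edge of length `δ`; `dist(·, c)` is convex, so the far endpoint of the far
segment is far; segment indices are monotone in the parameter; `r + δ < ε` separates the indices). -/
def PolylineToVertex : Prop :=
  ∀ (Ω : Set ℂ) (δ : ℝ) (u v : Site 2) (γ : DomainSAW Ω δ u v) (c : ℂ) (ε r : ℝ),
    0 < δ → r + δ < ε → PolyDeepReturn ε r c γ →
      ∃ i j : ℕ, i < j ∧ j ≤ γ.walk.length ∧ ε ≤ dist (meshPoint δ (γ.walk.getVert i)) c ∧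
        dist (meshPoint δ (γ.walk.getVert j)) c ≤ r + δ

/-- **Glue of D1 (kernel-checked): piece 1 (sup-form dive bound for the round-ball cut) + the
annealed Markov reduction + the polyline lemma ⇒ the crux BY NAME.** Choices: `E := ε/2`,
`r := ρ/2`, and `δ < ρ/2`. -/
theorem noDeepReturn_of_markovCut (hP : RootPenetrationSupAt ballCut) (hR : FirstEntryReduction)
    (hV : PolylineToVertex) : Crux := by
  intro D a b hab ε hε η hη
  obtain ⟨ρ, hρ, hρE, hev⟩ := hP D a b hab (ε / 2) (half_pos hε) η hη
  refine ⟨ρ / 2, half_pos hρ, ?_⟩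
  have hsmall : ∀ᶠ δ in 𝓝[>] (0 : ℝ), δ < ρ / 2 :=
    (nhdsWithin_le_nhds (Iio_mem_nhds (half_pos hρ)))
  have hpos : ∀ᶠ δ in 𝓝[>] (0 : ℝ), (0 : ℝ) < δ := self_mem_nhdsWithin
  filter_upwards [hev, hsmall, hpos] with δ h1 hδρ hδ0
  -- polyline event ⊆ vertex event for the round-ball cut
  have hsub : {γ : DomainSAW D.carrier δ (a δ) (b δ) | PolyDeepReturn ε (ρ / 2) (D.pt 0) γ} ⊆
      {γ | VertexFarNear (ballCut D (ε / 2)) (closedBall (D.pt 0) ρ) γ} := by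
    intro γ hγ
    obtain ⟨i, j, hij, hj, hfar, hnear⟩ :=
      hV D.carrier δ (a δ) (b δ) γ (D.pt 0) ε (ρ / 2) hδ0 (by linarith) hγ
    refine ⟨i, j, hij, hj, ?_, ?_⟩
    · simp only [ballCut, mem_compl_iff, mem_closedBall, not_le]
      linarith
    · rw [mem_closedBall]
      linarith
  refine le_trans (measure_mono hsub) ?_
  exact hR D.carrier D.toJordanDomain.isBounded δ hδ0 (ballCut D (ε / 2)) (closedBall (D.pt 0) ρ)
    (a δ) (b δ) η hη.le (fun x α hα => h1 x α hα)

/-! ## §4 The lattice-local regime piece is a WEAKENING of the crux (and is itself open) -/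

/-- D2's weakest piece: LATTICE-LOCAL no return — after being `ε`-far from `a`, the walk does not
visit a vertex within `K` LATTICE steps (`K δ`) of its starting vertex `a δ`, with probability
`→ 1`. By re-rooting it is governed by the dive-restricted critical two-point function at distance
`≤ K`, i.e. by `Σₙ n pₙ μ^{-n} < ∞`-type finiteness (stmt-7117 class) — OPEN on `ℤ²`
(Madras–Slade 1993 §1.4, §8.1; Hammond's `θ ≥ 3/2` does not decide it). -/
def LocalRootNoReturn : Prop :=
  ∀ (D : DobrushinDomain) (a b : ℝ → Site 2), IsEndpointApprox D a b →
    ∀ ε : ℝ, 0 < ε → ∀ (K : ℕ) (η : ℝ), 0 < η → ∀ᶠ δ in 𝓝[>] (0 : ℝ),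
      law D.carrier δ (a δ) (b δ) {γ | ∃ s : unitInterval, ∃ j ≤ γ.walk.length,
        ε ≤ dist (γ.walk.toCurve (meshPoint δ) s) (D.pt 0) ∧
        (∃ t : unitInterval, s < t ∧ γ.walk.toCurve (meshPoint δ) t = meshPoint δ (γ.walk.getVert j)) ∧
        dist (meshPoint δ (γ.walk.getVert j)) (meshPoint δ (a δ)) ≤ K * δ} ≤ ENNReal.ofReal η

/-- **The lattice-local piece follows from the crux** (so D2's local regime is a genuine special
case): once `δ (K + 1) + dist(δ·a_δ, a) ≤ r`, a vertex within `K δ` of `a δ` is within `r` of `a`.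
-/
theorem localRootNoReturn_of_noDeepReturn (h : Crux) : LocalRootNoReturn := by
  intro D a b hab ε hε K η hη
  obtain ⟨r, hr, hev⟩ := h D a b hab ε hε η hη
  -- eventually `K δ ≤ r/2` and `dist (δ a_δ) a ≤ r/2`
  have hK : ∀ᶠ δ in 𝓝[>] (0 : ℝ), (K : ℝ) * δ ≤ r / 2 := by
    have ht : Tendsto (fun δ : ℝ => (K : ℝ) * δ) (𝓝[>] (0 : ℝ)) (𝓝 ((K : ℝ) * 0)) :=
      ((continuous_const.mul continuous_id).tendsto 0).mono_left nhdsWithin_le_nhds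
    rw [mul_zero] at ht
    exact (ht.eventually (Iic_mem_nhds (half_pos hr)))
  have ha : ∀ᶠ δ in 𝓝[>] (0 : ℝ), dist (meshPoint δ (a δ)) (D.pt 0) ≤ r / 2 :=
    (Metric.tendsto_nhds.1 hab.tendsto_fst (r / 2) (half_pos hr)).mono fun δ hδ => hδ.le
  filter_upwards [hev, hK, ha] with δ h1 h2 h3
  refine le_trans (measure_mono ?_) h1
  rintro γ ⟨s, j, hj, hfar, ⟨t, hst, ht⟩, hnear⟩
  refine ⟨s, t, hst, hfar, ?_⟩
  rw [ht]
  calc dist (meshPoint δ (γ.walk.getVert j)) (D.pt 0)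
      ≤ dist (meshPoint δ (γ.walk.getVert j)) (meshPoint δ (a δ)) + dist (meshPoint δ (a δ)) (D.pt 0) :=
        dist_triangle _ _ _
    _ ≤ r / 2 + r / 2 := add_le_add (hnear.trans h2) h3
    _ = r := by ring

/-! ## §5 S⁺₁ → crux (instantiation) -/

/-- The uniform strengthening implies the crux (so its refutation by fjords says only that `r`
must depend on the domain). -/
theorem noDeepReturn_of_uniform (h : UniformRootNoReturn) : Crux := by
  intro D a b hab ε hε η hη
  obtain ⟨r, hr, hall⟩ := h ε hε η hη
  exact ⟨r, hr, hall D a b hab⟩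

end Summit.CriticalPhenomena.SAWScalingLimit.Cruxes.NoDeepReturn.Strategist

end
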